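import Summits.BirchSwinnertonDyer.Rank1Residual.Additive.SignedTwistMinusTransverse
import Summits.BirchSwinnertonDyer.Rank1Residual.Additive.SignedTwistMinusCorankBoundCard
import Summits.BirchSwinnertonDyer.Rank1Residual.Additive.TransverseLineAlgebra
import HarnessLib

/-!
# B3 in level-`m` shape for the signed twist, modulo the Kummer-group data and `#H¹(ℚ_p, W[p^m])[p] ≤ p²`:
# the minus classes generate a cyclic line of order `p^m` complementary to the Kummer group
# (cell `b2b-bsdres`, CLASS-CLOSURE lane, class O10 — x1b GEN 40, class lead; file 94 of the series)

HONEST FRAMING (cell `b2b-bsdres`, run/shared/lean/b2b/bsd-rank1-residual/, verbatim in every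
file): the goal of the cell is to DELETE the COMBINATION-SHAPED residual classes of the
Birch–Swinnerton-Dyer formula for ALL analytic-rank `≤ 1` elliptic curves over `ℚ` — "full BSD
formula for every rank `≤ 1` curve in class `C`" assembled STRICTLY from published theorems — so
that the rank-`≤ 1` remainder becomes exactly the CONSTRUCTION-SHAPED classes, which are TYPED
(missing-input `Prop`s), NOT attempted. This is not "finishing BSD". CLASS-CLOSURE lane: prove
what is provable now; shrink each hard class to its core with data; no claim beyond stated classes;
research routes on CONSTRUCTION-SHAPED X12 / O10; census / instrument output = EVIDENCE / conjecture
items, NEVER a Literature fact; `RESIDUAL-MAP.md` marks change only by signed lines. THIS FILE: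
TOOL THEOREMS ONLY — no definition, no named Literature fact, no `sorry`, axioms standard; nothing
is booked; no label / mark / count / sub-cell moves; (C1_η), (C2_η-GZ), (C3_η) stay typed as filed
(cc-typer-6's pen); nothing about `BSD(W, p)` of any pair is claimed.

## What (currency of files 82/91/93: `H = H¹(ℚ_p, W[p^m]) = galoisCohomology (restrictField ℚ_[p]
## (W.torsionGaloisModule (p^m))) 1`; `MINUS(ξ)` = "ξ restricts on `Gal(ℚ̄_p/ℚ_n·ℚ_p)` to the Kummer
## cocycle of a `p^m`-th root of a zero-clause minus point"; `KUM(ξ)` = "ξ is the Kummer class of a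
## point of `W(ℚ_p)`")

* §1 `MINUS` is closed under `0`, `+`, `−`; hence **`minus_of_mem_closure`**: every element of the
  subgroup `Σ := AddSubgroup.closure {ξ | MINUS ξ}` satisfies `MINUS` (so `Σ` IS the level-`m` minus
  condition as a subgroup, with no new definition: x1b GEN 39 note §3 (iv), receptacle (α) inline).
* §2 **`closure_minus_sup_eq_top_and_card_eq`** (generic tower hypotheses of file 91, `2m ≤ n+1`):
  if `H` is finite and killed by `p^m` with `#H[p] ≤ p²` (inputs: `#H¹(ℚ_p, W[p]) = p²` by local
  duality + Euler characteristic, and `H¹(W[p]) ↠ H¹(W[p^m])[p]` — fact-shaped, NOT supplied here),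
  and `K ≤ H` has order `p^m`, an element of order `p^m`, and consists of `KUM` classes (the Kummer
  group `W(ℚ_p)/p^m`; files 67/70 at the `adicCompletion` model — NOT transported here), then
  **`Σ ⊔ K = ⊤`, `#Σ = p^m`, `#H = p^{2m}`, and `Σ` has an element of order `p^m`** — B3 in
  level-`m` shape (x1b GEN 39 file 83 `TransverseLine.sup_eq_top_and_card_eq` fed with file 92's
  `p^m ≤ #Σ` and file 93's `Σ ∩ K = 0`). `…_cyclotomic`: Kobayashi's setting.

References: [Kobayashi2003] S. Kobayashi, Invent. Math. 152 (2003), Thm. 6.2 (p. 11), Prop. 8.7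
(p. 16), Prop. 8.12 (p. 17), Lemma 8.17 (p. 19); [GreenbergLNM1716] §3 p. 86.
-/

noncomputable section

open scoped Classical

open WeierstrassCurve Field

namespace Summit.BirchSwinnertonDyer.Rank1Residual.Additive.SignedTwist

open Literature.NumberTheory.EllipticCurves Literature.NumberTheory.GaloisRepresentations
  Literature.NumberTheory.EllipticCurves.Kobayashi2003 Literature.NumberTheory.EllipticCurves.ZpDescent
  Summit.BirchSwinnertonDyer.Rank1Residual.AdditivePotMult
  Summit.BirchSwinnertonDyer.Rank1Residual.Additive.PadicCyclotomicTower
  ZpExtension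
open scoped ContRepresentation

/-! ## §1 The minus classes form a subgroup -/

section Closure

variable {K : Type} [Field K] (W : WeierstrassCurve K)
  {p : ℕ} [hp : Fact p.Prime] (κ : ZpExtension K p) (E : Type) [Field E] [Algebra K E]

/-- **Every element of the subgroup generated by the minus classes is a minus class** (the property
"restricts on `Gal(K̄_E/K_n·E)` to the Kummer cocycle of an `ℓ`-th root of a zero-clause minus
point" is closed under `0`, `+`, `−`). [cite: Kobayashi2003, Def. 2.1 (p. 5)] -/
theorem minus_of_mem_closure {ℓ : ℤ} (n : ℕ)
    {ξ : galoisCohomology (GaloisRep.restrictField E (W.torsionGaloisModule ℓ)) 1}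
    (hξ : ξ ∈ AddSubgroup.closure {ξ | ∃ x ∈ signedLocalPointsOfEmb κ (closureEmb (K := K) E) W (-1) n ⊓
          (localTraceOfEmb κ (closureEmb (K := K) E) W 0 n).ker,
        ∃ R : localPoints W E, ℓ • R = x ∧
        ∃ φ : contOneCocycles (DiscreteGaloisModule.toTopRep
            (GaloisRep.restrictField E (W.torsionGaloisModule ℓ))),
          oneCocycleClass _ φ = ξ ∧
          ∀ u ∈ localLayerSubgroupOfEmb κ (closureEmb (K := K) E) n,
            pointsMap W E ((φ.1 u : geomTorsion W ℓ) : geomPoints W) = u • R - R}) :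
    ∃ x ∈ signedLocalPointsOfEmb κ (closureEmb (K := K) E) W (-1) n ⊓
          (localTraceOfEmb κ (closureEmb (K := K) E) W 0 n).ker,
        ∃ R : localPoints W E, ℓ • R = x ∧
        ∃ φ : contOneCocycles (DiscreteGaloisModule.toTopRep
            (GaloisRep.restrictField E (W.torsionGaloisModule ℓ))),
          oneCocycleClass _ φ = ξ ∧
          ∀ u ∈ localLayerSubgroupOfEmb κ (closureEmb (K := K) E) n,
            pointsMap W E ((φ.1 u : geomTorsion W ℓ) : geomPoints W) = u • R - R := by
  set N := signedLocalPointsOfEmb κ (closureEmb (K := K) E) W (-1) n ⊓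
    (localTraceOfEmb κ (closureEmb (K := K) E) W 0 n).ker with hN
  induction hξ using AddSubgroup.closure_induction with
  | mem ξ h => exact h
  | zero =>
    refine ⟨0, N.zero_mem, 0, smul_zero _, 0, oneCocycleClass_zero _, fun u _ => ?_⟩
    rw [smul_zero, sub_zero]
    exact (pointsMap W E).map_zero
  | add ξ ξ' _ _ ih ih' =>
    obtain ⟨x, hx, R, hR, φ, hφ, hφu⟩ := ih
    obtain ⟨x', hx', R', hR', φ', hφ', hφu'⟩ := ih'
    refine ⟨x + x', N.add_mem hx hx', R + R', by rw [smul_add, hR, hR'], φ + φ',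
      by rw [oneCocycleClass_add, hφ, hφ']; exact rfl, fun u hu => ?_⟩
    have h : ((((φ + φ').1 u : geomTorsion W ℓ)) : geomPoints W) =
        ((φ.1 u : geomTorsion W ℓ) : geomPoints W) + ((φ'.1 u : geomTorsion W ℓ) : geomPoints W) := rfl
    rw [h, map_add, hφu u hu, hφu' u hu, smul_add]
    abel
  | neg ξ _ ih =>
    obtain ⟨x, hx, R, hR, φ, hφ, hφu⟩ := ih
    refine ⟨-x, N.neg_mem hx, -R, by rw [smul_neg, hR], -φ,
      by rw [← oneCocycleClassₗ_apply, map_neg, oneCocycleClassₗ_apply, hφ]; exact rfl, fun u hu => ?_⟩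
    have h : ((((-φ).1 u : geomTorsion W ℓ)) : geomPoints W) =
        -((φ.1 u : geomTorsion W ℓ) : geomPoints W) := rfl
    rw [h, map_neg, hφu u hu, smul_neg]
    abel

end Closure

/-! ## §2 B3 in level-`m` shape -/

section Generic

variable (W : WeierstrassCurve ℚ) [W.IsElliptic] (K₀ : Type) [Field K₀] [NumberField K₀] {θ : K₀} {c : ℚ}
  (hθ : θ ∉ Set.range (algebraMap ℚ K₀)) (hc : θ ^ 2 = algebraMap ℚ K₀ c)
  {p : ℕ} [hp : Fact p.Prime] (κ : ZpExtension ℚ p)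
  {V : WeierstrassCurve ℚ} [V.IsElliptic] {C : VariableChange ℚ} (hCV : C • W.quadraticTwist c = V)
  (η : absoluteGaloisGroup ℚ →* ℤˣ)
  (hη : ∀ σ : absoluteGaloisGroup ℚ, η σ = 1 ↔ σ • rootInClosure K₀ θ = rootInClosure K₀ θ)

include hθ hc hCV hη in
/-- **B3 IN LEVEL-`m` SHAPE (modulo the Kummer-group data and `#H[p] ≤ p²`).** Generic tower
hypotheses of file 91, `2m ≤ n + 1`. Let `H = H¹(ℚ_p, W[p^m])` be finite, killed by `p^m`, with
`#H[p] ≤ p²`; let `K ≤ H` have order `p^m`, an element of order `p^m`, and consist of Kummer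
classes of points of `W(ℚ_p)`. Then the subgroup `Σ` generated by the minus classes satisfies
`Σ ⊔ K = ⊤`, `#Σ = p^m`, `#H = p^{2m}`, and contains an element of order `p^m`.
[cite: Kobayashi2003, Thm. 6.2 (p. 11), Prop. 8.7 (p. 16), Prop. 8.12 (p. 17), Lemma 8.17 (p. 19)] -/
theorem closure_minus_sup_eq_top_and_card_eq
    (hD : ∀ g : absoluteGaloisGroup ℚ, ∃ τ : absoluteGaloisGroup ℚ_[p],
      (resGalOfEmb (closureEmb (K := ℚ) ℚ_[p]) τ)⁻¹ * g ∈ towerTopSubgroup κ K₀)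
    (hκ₀ : ∀ x, ∃ g ∈ galRange (K := ℚ) K₀, κ g = x) [(galRange (K := ℚ) K₀).Normal]
    (hidx : (galRange (K := ℚ) K₀).index ≤ p - 1) (hp2 : p ≠ 2)
    (M : WeierstrassCurve ℤ_[p]) [hE : (M.map PadicInt.Coe.ringHom).IsElliptic]
    [hEt : (M.map PadicInt.toZMod).IsElliptic]
    (htr : Literature.NumberTheory.EllipticCurves.HasseManin.tr (M.map PadicInt.toZMod) = 0)
    (hVM : M.baseChange (AlgebraicClosure ℚ_[p]) = V.baseChange (AlgebraicClosure ℚ_[p]))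
    (hU : ∀ n, localSubgroupOfEmb (towerSubgroup κ K₀ n) (closureEmb (K := ℚ) ℚ_[p]) = stab p (n + 1))
    {n m : ℕ} (hnm : 2 * m ≤ n + 1)
    [Finite (galoisCohomology (GaloisRep.restrictField ℚ_[p] (W.torsionGaloisModule ((p ^ m : ℕ) : ℤ))) 1)]
    (hexp : ∀ h : galoisCohomology (GaloisRep.restrictField ℚ_[p] (W.torsionGaloisModule ((p ^ m : ℕ) : ℤ))) 1,
      p ^ m • h = 0)
    (hHp : Nat.card (nsmulAddMonoidHom p : galoisCohomology
        (GaloisRep.restrictField ℚ_[p] (W.torsionGaloisModule ((p ^ m : ℕ) : ℤ))) 1 →+ _).ker ≤ p ^ 2)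
    (Kum : AddSubgroup (galoisCohomology
      (GaloisRep.restrictField ℚ_[p] (W.torsionGaloisModule ((p ^ m : ℕ) : ℤ))) 1))
    (hKcard : Nat.card Kum = p ^ m) (hk₀ : ∃ k ∈ Kum, addOrderOf k = p ^ m)
    (hKum : ∀ ξ ∈ Kum, ∃ Q ∈ localLayerPointsOfEmb κ (closureEmb (K := ℚ) ℚ_[p]) W 0,
        ∃ R' : localPoints W ℚ_[p], ((p ^ m : ℕ) : ℤ) • R' = Q ∧
        ∃ φ' : contOneCocycles (DiscreteGaloisModule.toTopRep
            (GaloisRep.restrictField ℚ_[p] (W.torsionGaloisModule ((p ^ m : ℕ) : ℤ)))),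
          oneCocycleClass _ φ' = ξ ∧
          ∀ u : absoluteGaloisGroup ℚ_[p],
            pointsMap W ℚ_[p] ((φ'.1 u : geomTorsion W ((p ^ m : ℕ) : ℤ)) : geomPoints W) = u • R' - R') :
    AddSubgroup.closure {ξ | ∃ x ∈ signedLocalPointsOfEmb κ (closureEmb (K := ℚ) ℚ_[p]) W (-1) n ⊓
          (localTraceOfEmb κ (closureEmb (K := ℚ) ℚ_[p]) W 0 n).ker,
        ∃ R : localPoints W ℚ_[p], ((p ^ m : ℕ) : ℤ) • R = x ∧
        ∃ φ : contOneCocycles (DiscreteGaloisModule.toTopRep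
            (GaloisRep.restrictField ℚ_[p] (W.torsionGaloisModule ((p ^ m : ℕ) : ℤ)))),
          oneCocycleClass _ φ = ξ ∧
          ∀ u ∈ localLayerSubgroupOfEmb κ (closureEmb (K := ℚ) ℚ_[p]) n,
            pointsMap W ℚ_[p] ((φ.1 u : geomTorsion W ((p ^ m : ℕ) : ℤ)) : geomPoints W) = u • R - R} ⊔
        Kum = ⊤ ∧
      Nat.card (AddSubgroup.closure {ξ | ∃ x ∈ signedLocalPointsOfEmb κ (closureEmb (K := ℚ) ℚ_[p]) W (-1) n ⊓
          (localTraceOfEmb κ (closureEmb (K := ℚ) ℚ_[p]) W 0 n).ker,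
        ∃ R : localPoints W ℚ_[p], ((p ^ m : ℕ) : ℤ) • R = x ∧
        ∃ φ : contOneCocycles (DiscreteGaloisModule.toTopRep
            (GaloisRep.restrictField ℚ_[p] (W.torsionGaloisModule ((p ^ m : ℕ) : ℤ)))),
          oneCocycleClass _ φ = ξ ∧
          ∀ u ∈ localLayerSubgroupOfEmb κ (closureEmb (K := ℚ) ℚ_[p]) n,
            pointsMap W ℚ_[p] ((φ.1 u : geomTorsion W ((p ^ m : ℕ) : ℤ)) : geomPoints W) = u • R - R}) =
        p ^ m ∧
      Nat.card (galoisCohomology (GaloisRep.restrictField ℚ_[p] (W.torsionGaloisModule ((p ^ m : ℕ) : ℤ))) 1) =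
        p ^ (2 * m) ∧
      ∃ s ∈ AddSubgroup.closure {ξ | ∃ x ∈ signedLocalPointsOfEmb κ (closureEmb (K := ℚ) ℚ_[p]) W (-1) n ⊓
          (localTraceOfEmb κ (closureEmb (K := ℚ) ℚ_[p]) W 0 n).ker,
        ∃ R : localPoints W ℚ_[p], ((p ^ m : ℕ) : ℤ) • R = x ∧
        ∃ φ : contOneCocycles (DiscreteGaloisModule.toTopRep
            (GaloisRep.restrictField ℚ_[p] (W.torsionGaloisModule ((p ^ m : ℕ) : ℤ)))),
          oneCocycleClass _ φ = ξ ∧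
          ∀ u ∈ localLayerSubgroupOfEmb κ (closureEmb (K := ℚ) ℚ_[p]) n,
            pointsMap W ℚ_[p] ((φ.1 u : geomTorsion W ((p ^ m : ℕ) : ℤ)) : geomPoints W) = u • R - R},
        addOrderOf s = p ^ m := by
  set S := AddSubgroup.closure {ξ | ∃ x ∈ signedLocalPointsOfEmb κ (closureEmb (K := ℚ) ℚ_[p]) W (-1) n ⊓
          (localTraceOfEmb κ (closureEmb (K := ℚ) ℚ_[p]) W 0 n).ker,
        ∃ R : localPoints W ℚ_[p], ((p ^ m : ℕ) : ℤ) • R = x ∧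
        ∃ φ : contOneCocycles (DiscreteGaloisModule.toTopRep
            (GaloisRep.restrictField ℚ_[p] (W.torsionGaloisModule ((p ^ m : ℕ) : ℤ)))),
          oneCocycleClass _ φ = ξ ∧
          ∀ u ∈ localLayerSubgroupOfEmb κ (closureEmb (K := ℚ) ℚ_[p]) n,
            pointsMap W ℚ_[p] ((φ.1 u : geomTorsion W ((p ^ m : ℕ) : ℤ)) : geomPoints W) = u • R - R}
    with hSdef
  -- transversality (file 93)
  have hdisj : ∀ ξ ∈ S, ξ ∈ Kum → ξ = 0 := fun ξ hξS hξK =>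
    eq_zero_of_minus_of_kummer W K₀ hθ hc κ hCV η hη hD hκ₀ hidx hp2 M htr hVM hU
      (minus_of_mem_closure W κ ℚ_[p] n hξS) (hKum ξ hξK)
  -- the corank bound (file 92)
  have hS : p ^ m ≤ Nat.card S :=
    pow_le_natCard_of_forall_minus_mem W K₀ hθ hc κ hCV η hη hD hκ₀ hidx hp2 M htr hVM hU hnm S
      (fun ξ hξ => AddSubgroup.subset_closure hξ)
  exact TransverseLine.sup_eq_top_and_card_eq hp.out m hexp hHp Kum S hKcard hk₀ hdisj hS

end Generic

section Cyclotomic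

variable (W : WeierstrassCurve ℚ) [W.IsElliptic] {p : ℕ} [hp : Fact p.Prime] (κ : ZpExtension ℚ p)
  {V : WeierstrassCurve ℚ} [V.IsElliptic]
  (F : Type) [Field F] [NumberField F] [IsCyclotomicExtension {p} ℚ F]

include F in
/-- **B3 in level-`m` shape, Kobayashi's setting** (`F = ℚ(μ_p)`, `θ = √p*`, `κ` cyclotomic,
`V = C • W^{(p*)}` with a good supersingular `a_p = 0` model, `p` odd, `2m ≤ n + 1`), modulo the
same finiteness / exponent / `#H[p] ≤ p²` / Kummer-group inputs. [cite: Kobayashi2003, §3 p. 5,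
Thm. 6.2 (p. 11), Prop. 8.7 (p. 16), Prop. 8.12 (p. 17), Lemma 8.17 (p. 19)] -/
theorem closure_minus_sup_eq_top_and_card_eq_cyclotomic (hp2 : p ≠ 2) (hκ : κ.IsCyclotomic)
    (C : VariableChange ℚ) (hCV : C • W.quadraticTwist ((-1) ^ (p / 2) * p) = V)
    (M : WeierstrassCurve ℤ_[p]) [hE : (M.map PadicInt.Coe.ringHom).IsElliptic]
    [hEt : (M.map PadicInt.toZMod).IsElliptic]
    (htr : Literature.NumberTheory.EllipticCurves.HasseManin.tr (M.map PadicInt.toZMod) = 0)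
    (hVM : M.baseChange (AlgebraicClosure ℚ_[p]) = V.baseChange (AlgebraicClosure ℚ_[p]))
    {n m : ℕ} (hnm : 2 * m ≤ n + 1)
    [Finite (galoisCohomology (GaloisRep.restrictField ℚ_[p] (W.torsionGaloisModule ((p ^ m : ℕ) : ℤ))) 1)]
    (hexp : ∀ h : galoisCohomology (GaloisRep.restrictField ℚ_[p] (W.torsionGaloisModule ((p ^ m : ℕ) : ℤ))) 1,
      p ^ m • h = 0)
    (hHp : Nat.card (nsmulAddMonoidHom p : galoisCohomology
        (GaloisRep.restrictField ℚ_[p] (W.torsionGaloisModule ((p ^ m : ℕ) : ℤ))) 1 →+ _).ker ≤ p ^ 2)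
    (Kum : AddSubgroup (galoisCohomology
      (GaloisRep.restrictField ℚ_[p] (W.torsionGaloisModule ((p ^ m : ℕ) : ℤ))) 1))
    (hKcard : Nat.card Kum = p ^ m) (hk₀ : ∃ k ∈ Kum, addOrderOf k = p ^ m)
    (hKum : ∀ ξ ∈ Kum, ∃ Q ∈ localLayerPointsOfEmb κ (closureEmb (K := ℚ) ℚ_[p]) W 0,
        ∃ R' : localPoints W ℚ_[p], ((p ^ m : ℕ) : ℤ) • R' = Q ∧
        ∃ φ' : contOneCocycles (DiscreteGaloisModule.toTopRep
            (GaloisRep.restrictField ℚ_[p] (W.torsionGaloisModule ((p ^ m : ℕ) : ℤ)))),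
          oneCocycleClass _ φ' = ξ ∧
          ∀ u : absoluteGaloisGroup ℚ_[p],
            pointsMap W ℚ_[p] ((φ'.1 u : geomTorsion W ((p ^ m : ℕ) : ℤ)) : geomPoints W) = u • R' - R') :
    AddSubgroup.closure {ξ | ∃ x ∈ signedLocalPointsOfEmb κ (closureEmb (K := ℚ) ℚ_[p]) W (-1) n ⊓
          (localTraceOfEmb κ (closureEmb (K := ℚ) ℚ_[p]) W 0 n).ker,
        ∃ R : localPoints W ℚ_[p], ((p ^ m : ℕ) : ℤ) • R = x ∧
        ∃ φ : contOneCocycles (DiscreteGaloisModule.toTopRep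
            (GaloisRep.restrictField ℚ_[p] (W.torsionGaloisModule ((p ^ m : ℕ) : ℤ)))),
          oneCocycleClass _ φ = ξ ∧
          ∀ u ∈ localLayerSubgroupOfEmb κ (closureEmb (K := ℚ) ℚ_[p]) n,
            pointsMap W ℚ_[p] ((φ.1 u : geomTorsion W ((p ^ m : ℕ) : ℤ)) : geomPoints W) = u • R - R} ⊔
        Kum = ⊤ ∧
      Nat.card (AddSubgroup.closure {ξ | ∃ x ∈ signedLocalPointsOfEmb κ (closureEmb (K := ℚ) ℚ_[p]) W (-1) n ⊓
          (localTraceOfEmb κ (closureEmb (K := ℚ) ℚ_[p]) W 0 n).ker,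
        ∃ R : localPoints W ℚ_[p], ((p ^ m : ℕ) : ℤ) • R = x ∧
        ∃ φ : contOneCocycles (DiscreteGaloisModule.toTopRep
            (GaloisRep.restrictField ℚ_[p] (W.torsionGaloisModule ((p ^ m : ℕ) : ℤ)))),
          oneCocycleClass _ φ = ξ ∧
          ∀ u ∈ localLayerSubgroupOfEmb κ (closureEmb (K := ℚ) ℚ_[p]) n,
            pointsMap W ℚ_[p] ((φ.1 u : geomTorsion W ((p ^ m : ℕ) : ℤ)) : geomPoints W) = u • R - R}) =
        p ^ m ∧
      Nat.card (galoisCohomology (GaloisRep.restrictField ℚ_[p] (W.torsionGaloisModule ((p ^ m : ℕ) : ℤ))) 1) =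
        p ^ (2 * m) ∧
      ∃ s ∈ AddSubgroup.closure {ξ | ∃ x ∈ signedLocalPointsOfEmb κ (closureEmb (K := ℚ) ℚ_[p]) W (-1) n ⊓
          (localTraceOfEmb κ (closureEmb (K := ℚ) ℚ_[p]) W 0 n).ker,
        ∃ R : localPoints W ℚ_[p], ((p ^ m : ℕ) : ℤ) • R = x ∧
        ∃ φ : contOneCocycles (DiscreteGaloisModule.toTopRep
            (GaloisRep.restrictField ℚ_[p] (W.torsionGaloisModule ((p ^ m : ℕ) : ℤ)))),
          oneCocycleClass _ φ = ξ ∧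
          ∀ u ∈ localLayerSubgroupOfEmb κ (closureEmb (K := ℚ) ℚ_[p]) n,
            pointsMap W ℚ_[p] ((φ.1 u : geomTorsion W ((p ^ m : ℕ) : ℤ)) : geomPoints W) = u • R - R},
        addOrderOf s = p ^ m := by
  obtain ⟨θ, hθ2⟩ := exists_sq_eq_pStar p F hp2
  have hc : θ ^ 2 = algebraMap ℚ F ((-1) ^ (p / 2) * p) := by
    rw [hθ2, map_mul, map_pow, map_neg, map_one, map_natCast]
  have hθ : θ ∉ Set.range (algebraMap ℚ F) := by
    rintro ⟨q, hq⟩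
    apply sq_ne_neg_one_pow_mul_prime hp.out (p / 2) q
    apply (algebraMap ℚ F).injective
    rw [map_pow, hq, hc]
  obtain ⟨η, hη⟩ := exists_eta_iff_smul_rootInClosure F hθ hc
  haveI := normal_galRange_cyclotomic p F
  exact closure_minus_sup_eq_top_and_card_eq W F hθ hc κ hCV η hη (localTowerHyp_padic p κ F hκ)
    (kappa_surjOn_galRange_cyclotomic κ F) (index_galRange_cyclotomic p F).le hp2 M htr hVM
    (localSubgroupOfEmb_towerSubgroup_eq_stab_rat F (closureEmb (K := ℚ) ℚ_[p]) κ hp2 hκ) hnm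
    hexp hHp Kum hKcard hk₀ hKum

end Cyclotomic

end Summit.BirchSwinnertonDyer.Rank1Residual.Additive.SignedTwist

end
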